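import Summits.ABC.ABC.Theorems.RibetTakahashiSplitManyPrimeValuationProductStubPeriodFormDegree
import HarnessLib

/-!
# The mean square of a period-lattice form does not depend on the fundamental domain —
# stub `stub_periodFormInvariance` of crux line `jl-zero-cycle-height`
# (crux `RibetTakahashiSplit.ManyPrimeValuationProduct`, stmt-ABC-1561)

Companion of `RibetTakahashiSplitManyPrimeValuationProductStubPeriodFormDegree.lean` (Frey's identity
`∫_F |s|² y² dμ = d · covol(Λ_L)` for every non-zero period-lattice form `s` on a compact Shimura
curve `X₀^D(M)`, `D > 1`, and every fundamental domain `F`). The degree `d` there is the fibre count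
of `Γτ ↦ ∫_{τ₀}^τ s (mod Λ_L)` supplied by `ShimuraCurveData.exists_deg_of_hasPeriodsIn` — it does not
mention `F` — so the identity gives at once:

* `lintegral_normSq_eq_of_isHypFundamentalDomain`, `integral_normSq_eq_of_isHypFundamentalDomain` —
  **`∫_F |s|² y² dμ = ∫_{F'} |s|² y² dμ` for any two fundamental domains `F, F'` of `X.Gamma`**
  (the un-normalised Petersson norm of a period-lattice form is well defined on `Γ∖ℍ`);
* the registered conjunction `stub_periodFormInvariance`.

For the crux line this removes the last analytic side condition from the minimal lever
`MeanSquareLowerBound`: both `vol(F)` (tree: `ShimuraCurveData.volume_eq_volume_fd`) and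
`∫_F |s|²_pt` are independent of `F`, so the lever on an arbitrary fundamental domain reduces to the
datum's own `X.fd`, where `log |s|²_pt` is integrable by the discharged fact
`shimuraCurve_pet_pos_ae_and_log_integrable` (skeleton rev c2, `meanSquareLowerBound_iff_clean'`).
Vignéras, LNM 800, Ch. IV §1 (integrals of `Γ`-invariant functions over a fundamental domain do not
depend on its choice); here obtained through the degree rather than by unfolding.
-/

-- `Summit.ABC.ABC` is the mandated summit-side namespace (CONVENTIONS §2); the duplicate is deliberate.
set_option linter.dupNamespace false

noncomputable section

open scoped MatrixGroups ENNReal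
open MeasureTheory
open UpperHalfPlane hiding I

namespace Summit.ABC.ABC.Theorems.ManyPrimeValuationProduct.PeriodForm

open Literature.NumberTheory.Automorphic

variable {D M : ℕ} (hD : 1 < D) (X : ShimuraCurveData D M) {F F' : Set ℍ}
  (hF : IsHypFundamentalDomain X.Gamma F) (hF' : IsHypFundamentalDomain X.Gamma F')
  (s : CuspForm X.Gamma 2) (hs : s ≠ 0) (L : PeriodPair)
  (hper : HasPeriodsIn X.Gamma s (L.lattice : Set ℂ))

include hD hF hF' hs hper in
/-- **`∫⁻_F |s|² y² dμ = ∫⁻_{F'} |s|² y² dμ`** for two fundamental domains of `Γ₀^D(M)` (`D > 1`) and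
a non-zero period-lattice form `s`: both sides are `d · covol(Λ_L)` for the SAME degree `d` of
`Γτ ↦ ∫_{i}^τ s (mod Λ_L)` (`ShimuraCurveData.exists_deg_of_hasPeriodsIn`, `lintegral_normSq_eq`).
[cite: VignerasLNM800, Ch. IV §1 (domaine fondamental)] -/
theorem lintegral_normSq_eq_of_isHypFundamentalDomain :
    ∫⁻ τ in F, ENNReal.ofReal (‖s τ‖ ^ 2 * τ.im ^ 2) =
      ∫⁻ τ in F', ENNReal.ofReal (‖s τ‖ ^ 2 * τ.im ^ 2) := by
  obtain ⟨d, hd, hfin⟩ :=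
    X.exists_deg_of_hasPeriodsIn hD s (coe_ne_zero X s hs) L hper UpperHalfPlane.I
  rw [lintegral_normSq_eq s UpperHalfPlane.I hF (coe_ne_zero X s hs) hper hd hfin,
    lintegral_normSq_eq s UpperHalfPlane.I hF' (coe_ne_zero X s hs) hper hd hfin]

include hD hF hF' hs hper in
/-- **The mean square of a period-lattice form is independent of the fundamental domain**:
`∫_F |s|² y² dμ = ∫_{F'} |s|² y² dμ` (Bochner integrals; both are `toReal` of the same finite
`ℝ≥0∞`-integral). [cite: VignerasLNM800, Ch. IV §1 (domaine fondamental)] -/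
theorem integral_normSq_eq_of_isHypFundamentalDomain :
    ∫ τ in F, ‖s τ‖ ^ 2 * τ.im ^ 2 = ∫ τ in F', ‖s τ‖ ^ 2 * τ.im ^ 2 := by
  have hmeas : ∀ G : Set ℍ, AEStronglyMeasurable (fun τ : ℍ ↦ ‖s τ‖ ^ 2 * τ.im ^ 2)
      (volume.restrict G) := fun G ↦
    (((ModularFormClass.continuous s).norm.pow 2).mul (continuous_im.pow 2)).aestronglyMeasurable
  have h0 : ∀ G : Set ℍ, 0 ≤ᵐ[volume.restrict G] fun τ : ℍ ↦ ‖s τ‖ ^ 2 * τ.im ^ 2 := fun G ↦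
    Filter.Eventually.of_forall fun τ ↦ (by positivity : (0 : ℝ) ≤ ‖s τ‖ ^ 2 * τ.im ^ 2)
  rw [integral_eq_lintegral_of_nonneg_ae (h0 F) (hmeas F),
    integral_eq_lintegral_of_nonneg_ae (h0 F') (hmeas F'),
    lintegral_normSq_eq_of_isHypFundamentalDomain hD X hF hF' s hs L hper]

end PeriodForm

/-- **Registered stub `stub_periodFormInvariance` of the crux line `jl-zero-cycle-height`** (crux
`RibetTakahashiSplit.ManyPrimeValuationProduct`, stmt-ABC-1561): on a compact Shimura curve
(`1 < D`) the mean square `∫_F |s|² y² dμ` of a non-zero weight-two form with periods in a lattice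
`Λ_L` is the same for any two fundamental domains `F, F'` of `X.Gamma`. [folklore] -/
theorem stub_periodFormInvariance : ∀ {D M : ℕ}, 1 < D →
    ∀ (X : Literature.NumberTheory.Automorphic.ShimuraCurveData D M) (F F' : Set UpperHalfPlane),
      Literature.NumberTheory.Automorphic.IsHypFundamentalDomain X.Gamma F →
      Literature.NumberTheory.Automorphic.IsHypFundamentalDomain X.Gamma F' →
    ∀ (s : CuspForm X.Gamma 2), s ≠ 0 → ∀ (L : PeriodPair),
      Literature.NumberTheory.Automorphic.HasPeriodsIn X.Gamma s (L.lattice : Set ℂ) →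
      ∫ z in F, ‖s z‖ ^ 2 * z.im ^ 2 = ∫ z in F', ‖s z‖ ^ 2 * z.im ^ 2 :=
  fun hD X _ _ hF hF' s hs L hper =>
    PeriodForm.integral_normSq_eq_of_isHypFundamentalDomain hD X hF hF' s hs L hper

end Summit.ABC.ABC.Theorems.ManyPrimeValuationProduct

end
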